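import Summits.MatrixMultiplication.OmegaCensus.DominoZpZpCells
import Summits.MatrixMultiplication.OmegaCensus.DominoZ5Z5Cover7
import HarnessLib

/-!
# No domino cube law with a part of size `7` over any `A ↠ ℤ_5 × ℤ_5`

ω-census `pub-omega`, family (b3), seat pub-omega-group gen 22 (pattern of g20's `DominoZ5Z5Part8.lean`).  Framing: lottery ticket;
floor = certified bounds/negative ranges.  VALUE: kernel theorems of the `ℤ_p²`-quotient column (`p = 5`) of the Dih-side mod-one
classification — the census cells `(1,7,19)@400` ×2 (`ℤ₅²×ℤ₁₆`, `ℤ₂×ℤ₅²×ℤ₈`) and `(1,7,44)@925` and every larger order, any `c₀` — as instances of the generic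
`DominoZpZpCells.lean` (cover hypothesis from the kernel enumeration `exists_table_entry_5_7` assembled here from `DominoZ5Z5Cover7.lean`, scaling-canonical
certified line table `tableZ5d7c` (`DominoZ5LineTable7A.lean`, 85 entries; g19's full `DominoZ5LineTable7` has no olean), half `η = 3`); NOT progress on ω.  (g19's bundled parts-6/7 route is held by a wedged olean;
this file covers part 7 alone.)

* `no_law_cube_1de7_of_onto_z5z5` / `no_law_cube_1d_e7_of_onto_z5z5` — part `7` in `T` / in `U`;
* the named cells `no_law_cube_17e_of_onto_z5z5` and `no_law_cube_1d7_of_onto_z5z5`.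
-/

namespace Summit.MatrixMultiplication.OmegaCensus

open Finset ZpZpDomino Literature.Combinatorics.Additive

variable {A : Type} [AddCommGroup A] [DecidableEq A] [Fintype A] {G : Type} [Group G] [DecidableEq G]
  {ρ τ : A → G} {c₀ : A} {S T U : Finset G}

namespace ZpZpDomino

/-- Every entry of the part-`7` table is a valid certificate. [folklore] -/
theorem tableZ5d7c_cert : ∀ e ∈ tableZ5d7c, lineCert 5 (vecFn e.1) e.2 = true := by
  intro e he
  exact tableZ5d7ca_cert e he

/-- **Every value function of sum `7` on `ZMod 5 × ZMod 5` (as `25` values) in normal form has a line direction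
whose count vector is, up to a unit scaling of `ZMod 5`, a certified entry of the canonical table.** [folklore] -/
theorem exists_table_entry_5_7 (g : Fin (5 * 5) → ℕ) (hg : ∑ i, g i = 7)
    (hNF : (1 ≤ g ⟨5, by decide⟩ ∧ 1 ≤ g ⟨1, by decide⟩) ∨
      (1 ≤ g ⟨5, by decide⟩ ∧ ∀ i : Fin (5 * 5), i.val % 5 ≠ 0 → g i = 0) ∨ (∀ i : Fin (5 * 5), i.val ≠ 0 → g i = 0)) :
    ∃ j < 5 + 1, ∃ k : ℕ, k % 5 ≠ 0 ∧ ∃ e ∈ tableZ5d7c, ∀ v < 5,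
      e.1.getD (k * v % 5) 0 = ∑ i : Fin (5 * 5), pick v (pv 5 j i.val) (g i) := by
  refine exists_entry_of_cover_scaled Nat.prime_five tableZ5d7c passTreeZ5d7 tabTreeZ5d7 (fun _ h => mem_tabTree h)
    passTreeZ5d7_sound (K := 2) (m := 3) (by norm_num)
    (fun k hk => ?_) cover_5_7_nf2 cover_5_7_nf3 ⟨5, by decide⟩ ⟨1, by decide⟩ rfl rfl g hg hNF
  interval_cases k
  · exact cover_5_7_nf1_0
  · exact cover_5_7_nf1_1
  · exact cover_5_7_nf1_2

end ZpZpDomino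

/-- The cover hypothesis of `DominoZpZpCells` for `p = 5` and the part sizes with a kernel enumeration. [folklore] -/
theorem exists_cover_z5z5_seven {d : ℕ} (hd : d = 7) :
    ∃ Tb : List (List ℕ × List (ℕ × List ℕ)), (∀ e ∈ Tb, lineCert 5 (vecFn e.1) e.2 = true) ∧
      ∀ g : Fin (5 * 5) → ℕ, ∑ i, g i = d →
        ((1 ≤ g ⟨5, by decide⟩ ∧ 1 ≤ g ⟨1, by decide⟩) ∨ (1 ≤ g ⟨5, by decide⟩ ∧ ∀ i : Fin (5 * 5), i.val % 5 ≠ 0 → g i = 0) ∨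
          (∀ i : Fin (5 * 5), i.val ≠ 0 → g i = 0)) →
        ∃ j < 5 + 1, ∃ k : ℕ, k % 5 ≠ 0 ∧ ∃ e ∈ Tb, ∀ v < 5,
          e.1.getD (k * v % 5) 0 = ∑ i : Fin (5 * 5), pick v (pv 5 j i.val) (g i) := by
  haveI : Fact (Nat.Prime 5) := ⟨Nat.prime_five⟩
  subst hd
  exact ⟨tableZ5d7c, tableZ5d7c_cert, exists_table_entry_5_7⟩

/-- **No `(1,1 | d,d | e,e)` law triple over `A ↠ ℤ_5 × ℤ_5` for `d ∈ {7}`**: dihedral-like `G` over `A` (any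
`c₀`), `φ : A →+ ZMod 5 × ZMod 5` onto, TPP triple with coset parts `|S₀| = |S₁| = 1`, `|T₀| = |T₁| = d`, `|U₀| = |U₁|` ⇒
`3|S||T||U| + 8 ≠ 8|A|`. [folklore] -/
theorem no_law_cube_1de7_of_onto_z5z5 {d : ℕ} (hd : d = 7)
    (hρρ : ∀ a b, ρ a * ρ b = ρ (a + b)) (hρτ : ∀ a b, ρ a * τ b = τ (b - a))
    (hτρ : ∀ a b, τ a * ρ b = τ (a + b)) (hττ : ∀ a b, τ a * τ b = ρ (c₀ + b - a))
    (hρ : Function.Injective ρ) (hτ : Function.Injective τ) (hne : ∀ a b, ρ a ≠ τ b)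
    (hsurj : ∀ g, (∃ a, ρ a = g) ∨ (∃ a, τ a = g))
    (φ : A →+ ZMod 5 × ZMod 5) (hφ : Function.Surjective φ)
    (h : TripleProductProperty S T U)
    (hS₀ : (univ.filter fun a : A => ρ a ∈ S).card = 1) (hS₁ : (univ.filter fun a : A => τ a ∈ S).card = 1)
    (hT₀ : (univ.filter fun a : A => ρ a ∈ T).card = d) (hT₁ : (univ.filter fun a : A => τ a ∈ T).card = d)
    (hU : (univ.filter fun a : A => ρ a ∈ U).card = (univ.filter fun a : A => τ a ∈ U).card)
    (hV : 3 * (S.card * T.card * U.card) + 8 = 8 * Fintype.card A) : False := by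
  have hη5 : (3 : ZMod 5) + 3 = 1 := by decide
  haveI : Fact (Nat.Prime 5) := ⟨Nat.prime_five⟩
  obtain ⟨Tb, hTb, hcov⟩ := exists_cover_z5z5_seven hd
  exact no_law_cube_1de_of_onto_zpzp_of_cover (3 : ZMod 5) hη5 Tb hTb ⟨5, by decide⟩ ⟨1, by decide⟩ rfl rfl hcov
    hρρ hρτ hτρ hττ hρ hτ hne hsurj φ hφ h hS₀ hS₁ hT₀ hT₁ hU hV

/-- **No `(1,1 | d,d | e,e)` law triple over `A ↠ ℤ_5 × ℤ_5` for `e ∈ {7}`** (the small parts in `U`).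
[folklore] -/
theorem no_law_cube_1d_e7_of_onto_z5z5 {e : ℕ} (he : e = 7)
    (hρρ : ∀ a b, ρ a * ρ b = ρ (a + b)) (hρτ : ∀ a b, ρ a * τ b = τ (b - a))
    (hτρ : ∀ a b, τ a * ρ b = τ (a + b)) (hττ : ∀ a b, τ a * τ b = ρ (c₀ + b - a))
    (hρ : Function.Injective ρ) (hτ : Function.Injective τ) (hne : ∀ a b, ρ a ≠ τ b)
    (hsurj : ∀ g, (∃ a, ρ a = g) ∨ (∃ a, τ a = g))
    (φ : A →+ ZMod 5 × ZMod 5) (hφ : Function.Surjective φ)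
    (h : TripleProductProperty S T U)
    (hS₀ : (univ.filter fun a : A => ρ a ∈ S).card = 1) (hS₁ : (univ.filter fun a : A => τ a ∈ S).card = 1)
    (hT : (univ.filter fun a : A => ρ a ∈ T).card = (univ.filter fun a : A => τ a ∈ T).card)
    (hU₀ : (univ.filter fun a : A => ρ a ∈ U).card = e) (hU₁ : (univ.filter fun a : A => τ a ∈ U).card = e)
    (hV : 3 * (S.card * T.card * U.card) + 8 = 8 * Fintype.card A) : False := by
  have hη5 : (3 : ZMod 5) + 3 = 1 := by decide
  haveI : Fact (Nat.Prime 5) := ⟨Nat.prime_five⟩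
  obtain ⟨Tb, hTb, hcov⟩ := exists_cover_z5z5_seven he
  exact no_law_cube_1d_e_of_onto_zpzp_of_cover (3 : ZMod 5) hη5 Tb hTb ⟨5, by decide⟩ ⟨1, by decide⟩ rfl rfl hcov
    hρρ hρτ hτρ hττ hρ hτ hne hsurj φ hφ h hS₀ hS₁ hT hU₀ hU₁ hV

/-- **Cell form `(1, 7, e)` over `A ↠ ℤ_5²**: no TPP triple with parts `(1,1 | 7,7 | e,e)` attains the mod-one law.
[folklore] -/
theorem no_law_cube_17e_of_onto_z5z5
    (hρρ : ∀ a b, ρ a * ρ b = ρ (a + b)) (hρτ : ∀ a b, ρ a * τ b = τ (b - a))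
    (hτρ : ∀ a b, τ a * ρ b = τ (a + b)) (hττ : ∀ a b, τ a * τ b = ρ (c₀ + b - a))
    (hρ : Function.Injective ρ) (hτ : Function.Injective τ) (hne : ∀ a b, ρ a ≠ τ b)
    (hsurj : ∀ g, (∃ a, ρ a = g) ∨ (∃ a, τ a = g))
    (φ : A →+ ZMod 5 × ZMod 5) (hφ : Function.Surjective φ)
    (h : TripleProductProperty S T U)
    (hS₀ : (univ.filter fun a : A => ρ a ∈ S).card = 1) (hS₁ : (univ.filter fun a : A => τ a ∈ S).card = 1)
    (hT₀ : (univ.filter fun a : A => ρ a ∈ T).card = 7) (hT₁ : (univ.filter fun a : A => τ a ∈ T).card = 7)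
    (hU : (univ.filter fun a : A => ρ a ∈ U).card = (univ.filter fun a : A => τ a ∈ U).card)
    (hV : 3 * (S.card * T.card * U.card) + 8 = 8 * Fintype.card A) : False :=
  no_law_cube_1de7_of_onto_z5z5 (rfl) hρρ hρτ hτρ hττ hρ hτ hne hsurj φ hφ h hS₀ hS₁ hT₀ hT₁ hU hV

/-- **Cell form `(1, d, 7)`** over `A ↠ ℤ_5²` (the parts `7` in `U`). [folklore] -/
theorem no_law_cube_1d7_of_onto_z5z5
    (hρρ : ∀ a b, ρ a * ρ b = ρ (a + b)) (hρτ : ∀ a b, ρ a * τ b = τ (b - a))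
    (hτρ : ∀ a b, τ a * ρ b = τ (a + b)) (hττ : ∀ a b, τ a * τ b = ρ (c₀ + b - a))
    (hρ : Function.Injective ρ) (hτ : Function.Injective τ) (hne : ∀ a b, ρ a ≠ τ b)
    (hsurj : ∀ g, (∃ a, ρ a = g) ∨ (∃ a, τ a = g))
    (φ : A →+ ZMod 5 × ZMod 5) (hφ : Function.Surjective φ)
    (h : TripleProductProperty S T U)
    (hS₀ : (univ.filter fun a : A => ρ a ∈ S).card = 1) (hS₁ : (univ.filter fun a : A => τ a ∈ S).card = 1)
    (hT : (univ.filter fun a : A => ρ a ∈ T).card = (univ.filter fun a : A => τ a ∈ T).card)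
    (hU₀ : (univ.filter fun a : A => ρ a ∈ U).card = 7) (hU₁ : (univ.filter fun a : A => τ a ∈ U).card = 7)
    (hV : 3 * (S.card * T.card * U.card) + 8 = 8 * Fintype.card A) : False :=
  no_law_cube_1d_e7_of_onto_z5z5 (rfl) hρρ hρτ hτρ hττ hρ hτ hne hsurj φ hφ h hS₀ hS₁ hT hU₀ hU₁ hV

end Summit.MatrixMultiplication.OmegaCensus
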